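import Literature.AnabelianGeometry.EtaleTheta.ThetaRootOrbitsOfSetting
import Literature.IUT.HodgeArakelov.CohomologyAutFunctoriality
import HarnessLib

/-!
# [EtTh] Cor 2.8 (i)/(iii) at the §1 model, OUTER transport: conjugation by an element `x ∈ Π^tp_C`
# normalising `ι(Π^tp_X)`, read on classes through an automorphism pair `(α, β)` (support lemmas)

Mochizuki, *The Étale Theta Function …* [EtTh], Publ. RIMS 45 (2009), §2, Cor 2.8 (i), (iii), PRIMS PDF
p.42 (bib key `MochizukiEtTh2009`): "`γ` … induces an automorphism of [the subquotient] `Δ_Θ`"; "(iii) … if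
`γ` arises from an inner automorphism of `Π^tp_{Ẋ̲̲}` (resp. `Π^tp_{Ẋ̲}`; `Π^tp_{Ċ̲̲}`; `Π^tp_{Ċ̲}`), then `γ`
preserves `η̲̈^{Θ,l·ℤ}` (resp. `η̈^{Θ,l·ℤ}`; `η̲̈^{Θ,l·ℤ}`; `η̈^{Θ,l·ℤ}`)".

PROOF-ONLY support file (no `def`, no instance, no new `Prop`; cell abc-iut, layer L2, seat
abc-iut-w6-d051 — SPLIT S1 of abc-iut-w6-d049's OUTER-`γ` companion for node EtTh:Cor2.8(iii) clauses 3–4,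
W3-L2-02 lineage abc-iut-L2-t2 / abc-iut-L2-d3). abc-iut-L2-t2's `Discharge/Sec2Cor28iiiInnerOfEmbedding`
(p427195) computes the transport of the orbit data `ThetaOrbitData.ofEmbedding ε hC hS` by `(γ_x, Γ_Θ)` for
`x = ι σ` INNER (`σ ∈ Π^tp_X`): on representatives it is `ContH1.conj σ⁻¹`. THIS file does the same for an
ARBITRARY `x ∈ Π^tp_C` whose conjugation restricts to `ι(Π^tp_X)`, the restriction being presented as an
automorphism PAIR — the consumer's INPUT, nothing about `x` is asserted here —
`α : Π^tp_X ≃ₜ* Π^tp_X` with `ι (α g) = x · ι g · x⁻¹`, `β : (Π^tp_X)^Θ ≃ₜ* (Π^tp_X)^Θ` with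
`β ∘ toTheta = toTheta ∘ α`, `β^{±1}(Δ_Θ) ⊆ Δ_Θ`, `α^{±1}(Π^tp_Ÿ) ⊆ Π^tp_Ÿ`: then on representatives the
transport is abc-iut-L6-t1's `ContH1Aut.autCocycle` along the INVERSE pair `(α⁻¹, β⁻¹)`
(`CohomologyAutFunctoriality.lean`, p-landed), and on classes `ContH1Aut.autMap … α.symm β.symm`:
* `symm_toTheta_eq`, `ι_symm_eq`, `outer_conj_mem_PiYddtp/…PiYdduu` (+ inverse forms), `pull_outer_conj` —
  bookkeeping of the pair;
* `symm_coeffOf_of_induces_outer` — if `Γ_Θ` is INDUCED by `γ_x` on the cyclotome (`InducesOnTheta`), then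
  `Γ_Θ⁻¹ ∘ coeffOf = coeffOf ∘ β⁻¹` (outer form of t2's `symm_coeffOf_of_induces`);
* `outer_symm_transport`, `outer_image_classOf_eq`, `outer_image_rootClassOf_eq` — outer forms of t2's
  `symm_transport` / `image_classOf_eq` / `image_rootClassOf_eq`: the transported (root) class of `c` is the
  (root) class of `autMap α⁻¹ β⁻¹ c`;
* `outer_image_orbitColl_eq`, `outer_image_rootColl_eq` — orbit collections: if `autMap α⁻¹ β⁻¹ η̈^Θ = σ₀·η̈^Θ`
  (the [EtTh] content, a HYPOTHESIS here — abc-iut-L2-d3's census item P-C5, abc-iut-w6-d049's S2) and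
  `s ↦ α⁻¹(s)·σ₀` maps the conjugating set `S` onto itself, the collection is mapped onto itself (uses L6-t1's
  equivariance `ContH1Aut.autMap_conj`);
* `ContH1Aut.autCocycle_symm_autCocycle`, `ContH1Aut.autMap_symm_autMap_apply` — the inverse pair undoes the pair
  (generic, classical [cite: NeukirchSchmidtWingberg2008, I §5]);
* `ContH1Aut.autCocycle_symm_eq_conjCocycle`, `ContH1Aut.autMap_symm_eq_conj` — sanity: the inner case
  `α = conj σ`, `β = conj (φ σ)` recovers abc-iut-L2-t1/t2's `ContH1.conjCocycle σ⁻¹` / `ContH1.conj σ⁻¹`.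
HONEST FRAMING: [EtTh] is refereed; statements about the TYPED interface only; the outer datum `(x, α, β)` and
the P-C5 identity are hypotheses; no side is taken on [IUTchIII] Cor 3.12; typed ≠ proved.
-/

noncomputable section

namespace Literature.IUT.HodgeArakelov.ContH1Aut

open Literature.AnabelianGeometry.EtaleTheta

universe u

variable {G : Type u} {G' : Type u} [Group G] [TopologicalSpace G]
  [Group G'] [TopologicalSpace G'] [IsTopologicalGroup G']
  (φ : G →* G') (A : Subgroup G') [A.Normal] [IsMulCommutative A]

/-- **The inverse pair undoes the pair on cocycles**: `autCocycle α⁻¹ β⁻¹ (autCocycle α β f) = f`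
(pointwise `β⁻¹(β(f(α⁻¹(α y)))) = f y`). [cite: NeukirchSchmidtWingberg2008, I §5] -/
theorem autCocycle_symm_autCocycle (α : G ≃ₜ* G) (β : G' ≃ₜ* G') (hφ : ∀ g, β (φ g) = φ (α g))
    (hφ' : ∀ g, β.symm (φ g) = φ (α.symm g))
    (hA : ∀ a : G', a ∈ A → β a ∈ A) (hA' : ∀ a : G', a ∈ A → β.symm a ∈ A) {H H' : Subgroup G}
    (hH : ∀ x, x ∈ H' → α.symm x ∈ H) (hH' : ∀ x, x ∈ H → α.symm.symm x ∈ H') (f : contCocycles φ A H) :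
    autCocycle φ A α.symm β.symm hφ' hA' hH' (autCocycle φ A α β hφ hA hH f) = f := by
  refine Subtype.ext (funext fun y => Subtype.ext ?_)
  have key : (⟨α.symm ((⟨α.symm.symm (y : G), hH' y y.2⟩ : H') : G), hH _ (hH' y y.2)⟩ : H) = y :=
    Subtype.ext (by simp)
  rw [coe_autCocycle_apply, coe_autCocycle_apply, key, ContinuousMulEquiv.symm_apply_apply]

/-- **The inverse pair undoes the pair on classes**: `autMap α⁻¹ β⁻¹ (autMap α β c) = c` (same subgroup,
arbitrary membership proofs; cf. the restriction form `ContH1Aut.autMap_symm_autMap` of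
`CohomologyAutEquiv.lean` under `β(A) = A`). [cite: NeukirchSchmidtWingberg2008, I §5] -/
theorem autMap_symm_autMap_apply (α : G ≃ₜ* G) (β : G' ≃ₜ* G') (hφ : ∀ g, β (φ g) = φ (α g))
    (hφ' : ∀ g, β.symm (φ g) = φ (α.symm g))
    (hA : ∀ a : G', a ∈ A → β a ∈ A) (hA' : ∀ a : G', a ∈ A → β.symm a ∈ A) {H H' : Subgroup G}
    (hH : ∀ x, x ∈ H' → α.symm x ∈ H) (hH' : ∀ x, x ∈ H → α.symm.symm x ∈ H') (c : ContH1 φ A H) :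
    autMap φ A α.symm β.symm hφ' hA' hH' (autMap φ A α β hφ hA hH c) = c := by
  induction c using QuotientGroup.induction_on with
  | H f => rw [autMap_mk, autMap_mk, autCocycle_symm_autCocycle]

/-- **Sanity (inner case)**: for `α = conj σ`, `β = conj (φ σ)` the transport along the inverse pair
`(α⁻¹, β⁻¹)` IS abc-iut-L2-t1's conjugation of cocycles by `σ⁻¹` (`ContH1.conjCocycle σ⁻¹`), whatever the
auxiliary membership proofs. [cite: NeukirchSchmidtWingberg2008, I §5] -/
theorem autCocycle_symm_eq_conjCocycle [IsTopologicalGroup G] {H : Subgroup G} [H.Normal] (σ : G)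
    (α : G ≃ₜ* G) (hα : ∀ g, α g = σ * g * σ⁻¹) (β : G' ≃ₜ* G') (hβ : ∀ t, β t = φ σ * t * (φ σ)⁻¹)
    (hφ' : ∀ g, β.symm (φ g) = φ (α.symm g)) (hA' : ∀ a : G', a ∈ A → β.symm a ∈ A)
    (hH' : ∀ x, x ∈ H → α.symm.symm x ∈ H) (f : contCocycles φ A H) :
    autCocycle φ A α.symm β.symm hφ' hA' hH' f = ContH1.conjCocycle φ A σ⁻¹ f := by
  have hβs : ∀ t, β.symm t = (φ σ)⁻¹ * t * φ σ := fun t => by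
    apply β.injective
    rw [ContinuousMulEquiv.apply_symm_apply, hβ]
    group
  refine Subtype.ext (funext fun y => Subtype.ext ?_)
  have hy : (⟨α.symm.symm (y : G), hH' y y.2⟩ : H) = MulAut.conjNormal σ⁻¹⁻¹ y :=
    Subtype.ext (by rw [inv_inv, MulAut.conjNormal_apply]; exact hα y)
  rw [coe_autCocycle_apply, ContH1.conjCocycle_apply, hy, hβs, MulAut.conjNormal_apply, map_inv φ, inv_inv,
    inv_inv]

/-- **Sanity (inner case), on classes**: `autMap α⁻¹ β⁻¹ = ContH1.conj σ⁻¹` for `α = conj σ`,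
`β = conj (φ σ)`. [cite: NeukirchSchmidtWingberg2008, I §5] -/
theorem autMap_symm_eq_conj [IsTopologicalGroup G] {H : Subgroup G} [H.Normal] (σ : G)
    (α : G ≃ₜ* G) (hα : ∀ g, α g = σ * g * σ⁻¹) (β : G' ≃ₜ* G') (hβ : ∀ t, β t = φ σ * t * (φ σ)⁻¹)
    (hφ' : ∀ g, β.symm (φ g) = φ (α.symm g)) (hA' : ∀ a : G', a ∈ A → β.symm a ∈ A)
    (hH' : ∀ x, x ∈ H → α.symm.symm x ∈ H) (c : ContH1 φ A H) :
    autMap φ A α.symm β.symm hφ' hA' hH' c = ContH1.conj φ A σ⁻¹ c := by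
  induction c using QuotientGroup.induction_on with
  | H f => rw [autMap_mk, ContH1.conj_mk, autCocycle_symm_eq_conjCocycle φ A σ α hα β hβ]

end Literature.IUT.HodgeArakelov.ContH1Aut

namespace Literature.AnabelianGeometry.EtaleTheta

open Literature.AnabelianGeometry.SemiGraphs ThetaCovers Literature.IUT.HodgeArakelov

universe u

namespace ThetaSetting.EtaleThetaData.DoubleUnderline.OrbitEmbedding

variable {p : ℕ} [Fact p.Prime] {D : ThetaSetting p} {E : D.EtaleThetaData} {l : ℕ}
  {C : E.DoubleUnderline l} {T : TemperedCoverData.{u} l} (ε : C.OrbitEmbedding T)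
  {x : T.Gtp} {α : D.PiTemp ≃ₜ* D.PiTemp} {β : D.GtpTheta ≃ₜ* D.GtpTheta}

/-! ### Bookkeeping of the outer datum `(x, α, β)` -/

/-- `β⁻¹ ∘ toTheta = toTheta ∘ α⁻¹` from `β ∘ toTheta = toTheta ∘ α`. [cite: MochizukiEtTh2009, Cor 2.8(i) p.42] -/
theorem symm_toTheta_eq (hβ : ∀ g, β (D.toTheta g) = D.toTheta (α g)) (g : D.PiTemp) :
    β.symm (D.toTheta g) = D.toTheta (α.symm g) := by
  apply β.injective
  rw [ContinuousMulEquiv.apply_symm_apply, hβ, ContinuousMulEquiv.apply_symm_apply]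

/-- `ι (α⁻¹ g) = x⁻¹ · ι g · x` from `ι (α g) = x · ι g · x⁻¹`. [cite: MochizukiEtTh2009, Cor 2.8(i) p.42] -/
theorem ι_symm_eq (hα : ∀ g, ε.ι (α g) = x * ε.ι g * x⁻¹) (g : D.PiTemp) :
    ε.ι (α.symm g) = x⁻¹ * ε.ι g * x := by
  have h := hα (α.symm g)
  rw [ContinuousMulEquiv.apply_symm_apply] at h
  rw [h]; group

/-- `x` normalises `T.PiYddtp = ι(Π^tp_Ÿ)` when `α(Π^tp_Ÿ) ⊆ Π^tp_Ÿ`. [cite: MochizukiEtTh2009, Def 2.7 p.41] -/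
theorem outer_conj_mem_PiYddtp (hα : ∀ g, ε.ι (α g) = x * ε.ι g * x⁻¹)
    (hY : ∀ g, g ∈ D.GtpYdd → α g ∈ D.GtpYdd) (y : ↥T.PiYddtp) :
    x * (y : T.Gtp) * x⁻¹ ∈ T.PiYddtp := by
  obtain ⟨g, hg, hgy⟩ := Subgroup.mem_map.1 (ε.map_GtpYdd.ge y.2)
  rw [← hgy, ← hα]
  exact ε.map_GtpYdd.le ⟨α g, hY g hg, rfl⟩

/-- `x⁻¹` normalises `T.PiYddtp` when `α⁻¹(Π^tp_Ÿ) ⊆ Π^tp_Ÿ`. [cite: MochizukiEtTh2009, Def 2.7 p.41] -/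
theorem outer_inv_conj_mem_PiYddtp (hα : ∀ g, ε.ι (α g) = x * ε.ι g * x⁻¹)
    (hY' : ∀ g, g ∈ D.GtpYdd → α.symm g ∈ D.GtpYdd) (y : ↥T.PiYddtp) :
    x⁻¹ * (y : T.Gtp) * x ∈ T.PiYddtp := by
  obtain ⟨g, hg, hgy⟩ := Subgroup.mem_map.1 (ε.map_GtpYdd.ge y.2)
  rw [← hgy, ← ε.ι_symm_eq hα]
  exact ε.map_GtpYdd.le ⟨α.symm g, hY' g hg, rfl⟩

/-- `x` normalises `Π^tp_{Ÿ̲̲} = T.PiYddtp ∩ Π^tp_{X̲̲}` of `T` when `α` stabilises `Π^tp_Ÿ` and `Π^tp_{X̲̲} = C.Huu`.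
[cite: MochizukiEtTh2009, Def 2.7 p.41] -/
theorem outer_conj_mem_PiYdduu (hα : ∀ g, ε.ι (α g) = x * ε.ι g * x⁻¹)
    (hY : ∀ g, g ∈ D.GtpYdd → α g ∈ D.GtpYdd) (hU : ∀ g, g ∈ C.Huu → α g ∈ C.Huu)
    (g : ↥(T.PiYddtp ⊓ T.tp T.PiXuu)) :
    x * (g : T.Gtp) * x⁻¹ ∈ T.PiYddtp ⊓ T.tp T.PiXuu := by
  refine Subgroup.mem_inf.2 ⟨ε.outer_conj_mem_PiYddtp hα hY ⟨g, (Subgroup.mem_inf.1 g.2).1⟩, ?_⟩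
  obtain ⟨u, hu, huy⟩ := Subgroup.mem_map.1 (ε.map_Huu.ge (Subgroup.mem_inf.1 g.2).2)
  rw [← huy, ← hα]
  exact ε.map_Huu.le ⟨α u, hU u hu, rfl⟩

/-- `x⁻¹` normalises `Π^tp_{Ÿ̲̲}` of `T` when `α⁻¹` stabilises `Π^tp_Ÿ` and `Π^tp_{X̲̲}`.
[cite: MochizukiEtTh2009, Def 2.7 p.41] -/
theorem outer_inv_conj_mem_PiYdduu (hα : ∀ g, ε.ι (α g) = x * ε.ι g * x⁻¹)
    (hY' : ∀ g, g ∈ D.GtpYdd → α.symm g ∈ D.GtpYdd) (hU' : ∀ g, g ∈ C.Huu → α.symm g ∈ C.Huu)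
    (g : ↥(T.PiYddtp ⊓ T.tp T.PiXuu)) :
    x⁻¹ * (g : T.Gtp) * x ∈ T.PiYddtp ⊓ T.tp T.PiXuu := by
  refine Subgroup.mem_inf.2 ⟨ε.outer_inv_conj_mem_PiYddtp hα hY' ⟨g, (Subgroup.mem_inf.1 g.2).1⟩, ?_⟩
  obtain ⟨u, hu, huy⟩ := Subgroup.mem_map.1 (ε.map_Huu.ge (Subgroup.mem_inf.1 g.2).2)
  rw [← huy, ← ε.ι_symm_eq hα]
  exact ε.map_Huu.le ⟨α.symm u, hU' u hu, rfl⟩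

/-- `ι⁻¹` of an outer conjugate: `pull (x · y · x⁻¹) = α (pull y)`. [cite: MochizukiEtTh2009, Def 2.7 p.41] -/
theorem pull_outer_conj (hα : ∀ g, ε.ι (α g) = x * ε.ι g * x⁻¹) (y : ↥T.PiYddtp)
    (h : x * (y : T.Gtp) * x⁻¹ ∈ T.PiYddtp) :
    (ε.pull ⟨x * (y : T.Gtp) * x⁻¹, h⟩ : D.PiTemp) = α (ε.pull y : D.PiTemp) := by
  apply ε.injective_ι
  rw [ε.ι_pull, hα, ε.ι_pull]

/-! ### The induced automorphism of the cyclotome, and the transport of cocycles -/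

/-- If `Γ_Θ` is INDUCED (`ThetaOrbitData.InducesOnTheta`) by `γ_x` on the cyclotome
`ι(toTheta⁻¹Δ_Θ)/ι(Ker toTheta) ≅ Δ_Θ`, then `Γ_Θ⁻¹ ∘ coeffOf = coeffOf ∘ β⁻¹` on `Δ_Θ` (outer form of
abc-iut-L2-t2's `symm_coeffOf_of_induces`). [cite: MochizukiEtTh2009, Cor 2.8(i) p.42] -/
theorem symm_coeffOf_of_induces_outer (hC : D.Compat) (hS : D.Sec2Hyps) [hb : ε.bot.Normal]
    (hα : ∀ g, ε.ι (α g) = x * ε.ι g * x⁻¹) (hβ : ∀ g, β (D.toTheta g) = D.toTheta (α g))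
    (hΔ' : ∀ a, a ∈ D.DeltaTheta → β.symm a ∈ D.DeltaTheta) (ΓΘ : ε.Coeff ≃* ε.Coeff)
    (h : (ThetaOrbitData.ofEmbedding ε hC hS).InducesOnTheta (ThetaOrbitData.innerAutTop x) ΓΘ)
    (d : ↥D.DeltaTheta) :
    ΓΘ.symm (ε.coeffOf d) = ε.coeffOf ⟨β.symm d, hΔ' _ d.2⟩ := by
  obtain ⟨hΓ, hind⟩ := h
  have htop : ∀ t : ↥ε.top, x * (t : T.Gtp) * x⁻¹ ∈ ε.top := fun t => hΓ.le ⟨t, t.2, rfl⟩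
  have hind' : ∀ t : ↥ε.top, ΓΘ (t : ε.Coeff) = ((⟨_, htop t⟩ : ↥ε.top) : ε.Coeff) := fun t => hind t
  have hmem : ε.ι (α.symm (lift d)) ∈ ε.top := by
    rw [ε.ι_symm_eq hα]
    exact ε.normal_top.conj_mem' _ (ε.ι_lift_mem_top d) x
  rw [MulEquiv.symm_apply_eq]
  calc ε.coeffOf d = ((⟨ε.ι (lift d), ε.ι_lift_mem_top d⟩ : ↥ε.top) : ε.Coeff) := rfl
    _ = ((⟨x * ε.ι (α.symm (lift d)) * x⁻¹, htop ⟨_, hmem⟩⟩ : ↥ε.top) : ε.Coeff) := by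
        congr 1; apply Subtype.ext
        show ε.ι (lift d) = x * ε.ι (α.symm (lift d)) * x⁻¹
        rw [ε.ι_symm_eq hα]; group
    _ = ΓΘ (((⟨ε.ι (α.symm (lift d)), hmem⟩ : ↥ε.top) : ε.Coeff)) := (hind' ⟨_, hmem⟩).symm
    _ = ΓΘ (ε.coeffOf ⟨β.symm d, hΔ' _ d.2⟩) := by
        congr 1
        exact (ε.coeffOf_eq_mk (by rw [← symm_toTheta_eq hβ, toTheta_lift]) hmem).symm

/-- **Outer transport = `autCocycle α⁻¹ β⁻¹` on representatives**: for a cocycle `f` on `Π^tp_Ÿ` and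
`Γ_Θ⁻¹ ∘ coeffOf = coeffOf ∘ β⁻¹`, `Γ_Θ⁻¹(F(x · y · x⁻¹)) = (transport (autCocycle α⁻¹ β⁻¹ f))(y)` where
`F = transport f` (outer form of t2's `symm_transport`). [cite: MochizukiEtTh2009, Cor 2.8(iii) p.42] -/
theorem outer_symm_transport [hb : ε.bot.Normal]
    (hα : ∀ g, ε.ι (α g) = x * ε.ι g * x⁻¹) (hβ : ∀ g, β (D.toTheta g) = D.toTheta (α g))
    (hΔ' : ∀ a, a ∈ D.DeltaTheta → β.symm a ∈ D.DeltaTheta)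
    (hY : ∀ g, g ∈ D.GtpYdd → α g ∈ D.GtpYdd) (ΓΘ : ε.Coeff ≃* ε.Coeff)
    (hΘ : ∀ d : ↥D.DeltaTheta, ΓΘ.symm (ε.coeffOf d) = ε.coeffOf ⟨β.symm d, hΔ' _ d.2⟩)
    (f : ↥(contCocycles D.toTheta D.DeltaTheta D.GtpYdd)) (y : ↥T.PiYddtp)
    (hy : x * (y : T.Gtp) * x⁻¹ ∈ T.PiYddtp) :
    ΓΘ.symm (ε.transport f.1 ⟨_, hy⟩) =
      ε.transport (ContH1Aut.autCocycle D.toTheta D.DeltaTheta α.symm β.symm (symm_toTheta_eq hβ) hΔ'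
        (H := D.GtpYdd) (H' := D.GtpYdd) hY f).1 y := by
  have hAB : ε.pull ⟨_, hy⟩ = ⟨α.symm.symm (ε.pull y : D.PiTemp), hY _ (ε.pull y).2⟩ :=
    Subtype.ext (ε.pull_outer_conj hα y hy)
  show ΓΘ.symm (ε.coeffOf (f.1 (ε.pull ⟨_, hy⟩))) =
    ε.coeffOf ((ContH1Aut.autCocycle D.toTheta D.DeltaTheta α.symm β.symm (symm_toTheta_eq hβ) hΔ'
        (H := D.GtpYdd) (H' := D.GtpYdd) hY f).1 (ε.pull y))
  rw [hΘ, hAB]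
  congr 1

/-- **The transported class is the class of `autMap α⁻¹ β⁻¹ c`** (outer form of t2's `image_classOf_eq`):
the image of `classOf c` under `F ↦ Γ_Θ⁻¹ ∘ F ∘ γ_x` is `classOf (autMap α⁻¹ β⁻¹ c)`.
[cite: MochizukiEtTh2009, Cor 2.8(iii) p.42] -/
theorem outer_image_classOf_eq [hb : ε.bot.Normal]
    (hα : ∀ g, ε.ι (α g) = x * ε.ι g * x⁻¹) (hβ : ∀ g, β (D.toTheta g) = D.toTheta (α g))
    (hΔ : ∀ a, a ∈ D.DeltaTheta → β a ∈ D.DeltaTheta) (hΔ' : ∀ a, a ∈ D.DeltaTheta → β.symm a ∈ D.DeltaTheta)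
    (hY : ∀ g, g ∈ D.GtpYdd → α g ∈ D.GtpYdd) (hY' : ∀ g, g ∈ D.GtpYdd → α.symm g ∈ D.GtpYdd)
    (ΓΘ : ε.Coeff ≃* ε.Coeff)
    (hΘ : ∀ d : ↥D.DeltaTheta, ΓΘ.symm (ε.coeffOf d) = ε.coeffOf ⟨β.symm d, hΔ' _ d.2⟩)
    (hmem : ∀ y : ↥T.PiYddtp, x * (y : T.Gtp) * x⁻¹ ∈ T.PiYddtp) (c : D.H1 D.GtpYdd) :
    (fun F : ↥T.PiYddtp → ε.Coeff => fun y : ↥T.PiYddtp => ΓΘ.symm (F ⟨_, hmem y⟩)) '' ε.classOf c =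
      ε.classOf (ContH1Aut.autMap D.toTheta D.DeltaTheta α.symm β.symm (symm_toTheta_eq hβ) hΔ'
        (H := D.GtpYdd) (H' := D.GtpYdd) hY c) := by
  -- the inverse transport on classes: `autMap α β (autMap α⁻¹ β⁻¹ c) = c`
  have h1 : ContH1Aut.autMap D.toTheta D.DeltaTheta α β hβ hΔ (H := D.GtpYdd) (H' := D.GtpYdd) hY'
      (ContH1Aut.autMap D.toTheta D.DeltaTheta α.symm β.symm (symm_toTheta_eq hβ) hΔ'
        (H := D.GtpYdd) (H' := D.GtpYdd) hY c) = c :=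
    ContH1Aut.autMap_symm_autMap_apply D.toTheta D.DeltaTheta α.symm β.symm (symm_toTheta_eq hβ) hβ hΔ' hΔ
      hY hY' c
  ext F; constructor
  · rintro ⟨_, ⟨f, hf, rfl⟩, rfl⟩
    refine ⟨ContH1Aut.autCocycle D.toTheta D.DeltaTheta α.symm β.symm (symm_toTheta_eq hβ) hΔ'
      (H := D.GtpYdd) (H' := D.GtpYdd) hY f, ?_, ?_⟩
    · rw [← hf]
      exact (ContH1Aut.autMap_mk D.toTheta D.DeltaTheta α.symm β.symm (symm_toTheta_eq hβ) hΔ'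
        (H := D.GtpYdd) (H' := D.GtpYdd) hY f).symm
    · funext y
      exact ε.outer_symm_transport hα hβ hΔ' hY ΓΘ hΘ f y (hmem y)
  · rintro ⟨f', hf', rfl⟩
    refine ⟨ε.transport (ContH1Aut.autCocycle D.toTheta D.DeltaTheta α β hβ hΔ (H := D.GtpYdd)
        (H' := D.GtpYdd) hY' f').1,
      ⟨ContH1Aut.autCocycle D.toTheta D.DeltaTheta α β hβ hΔ (H := D.GtpYdd) (H' := D.GtpYdd) hY' f',
        ?_, rfl⟩, ?_⟩
    · calc ContH1.mk _ (ContH1Aut.autCocycle D.toTheta D.DeltaTheta α β hβ hΔ (H := D.GtpYdd)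
              (H' := D.GtpYdd) hY' f').2
          = ContH1Aut.autMap D.toTheta D.DeltaTheta α β hβ hΔ (H := D.GtpYdd) (H' := D.GtpYdd) hY'
              (QuotientGroup.mk f') :=
            (ContH1Aut.autMap_mk D.toTheta D.DeltaTheta α β hβ hΔ (H := D.GtpYdd) (H' := D.GtpYdd)
              hY' f').symm
        _ = ContH1Aut.autMap D.toTheta D.DeltaTheta α β hβ hΔ (H := D.GtpYdd) (H' := D.GtpYdd) hY'
              (ContH1Aut.autMap D.toTheta D.DeltaTheta α.symm β.symm (symm_toTheta_eq hβ) hΔ'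
                (H := D.GtpYdd) (H' := D.GtpYdd) hY c) := by
            rw [← hf']; rfl
        _ = c := h1
    · funext y
      show ΓΘ.symm (ε.transport (ContH1Aut.autCocycle D.toTheta D.DeltaTheta α β hβ hΔ (H := D.GtpYdd)
          (H' := D.GtpYdd) hY' f').1 ⟨_, hmem y⟩) = ε.transport f'.1 y
      rw [ε.outer_symm_transport hα hβ hΔ' hY ΓΘ hΘ _ y (hmem y),
        ContH1Aut.autCocycle_symm_autCocycle]

/-- **The transported root class is the root class of `autMap α⁻¹ β⁻¹ c`** (outer form of t2's
`image_rootClassOf_eq`): on `Π^tp_{Ÿ̲̲}`, the image of `rootClassOf c` under `ξ ↦ Γ_Θ⁻¹ ∘ ξ ∘ γ_x` is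
`rootClassOf (autMap α⁻¹ β⁻¹ c)`. [cite: MochizukiEtTh2009, Cor 2.8(iii) p.42] -/
theorem outer_image_rootClassOf_eq [hb : ε.bot.Normal]
    (hα : ∀ g, ε.ι (α g) = x * ε.ι g * x⁻¹) (hβ : ∀ g, β (D.toTheta g) = D.toTheta (α g))
    (hΔ : ∀ a, a ∈ D.DeltaTheta → β a ∈ D.DeltaTheta) (hΔ' : ∀ a, a ∈ D.DeltaTheta → β.symm a ∈ D.DeltaTheta)
    (hY : ∀ g, g ∈ D.GtpYdd → α g ∈ D.GtpYdd) (hY' : ∀ g, g ∈ D.GtpYdd → α.symm g ∈ D.GtpYdd)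
    (ΓΘ : ε.Coeff ≃* ε.Coeff)
    (hΘ : ∀ d : ↥D.DeltaTheta, ΓΘ.symm (ε.coeffOf d) = ε.coeffOf ⟨β.symm d, hΔ' _ d.2⟩)
    (hmem : ∀ y : ↥T.PiYddtp, x * (y : T.Gtp) * x⁻¹ ∈ T.PiYddtp)
    (hmem' : ∀ g : ↥(T.PiYddtp ⊓ T.tp T.PiXuu), x * (g : T.Gtp) * x⁻¹ ∈ T.PiYddtp ⊓ T.tp T.PiXuu)
    (hinv' : ∀ g : ↥(T.PiYddtp ⊓ T.tp T.PiXuu), x⁻¹ * (g : T.Gtp) * x ∈ T.PiYddtp ⊓ T.tp T.PiXuu)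
    (c : D.H1 D.GtpYdd) :
    (fun ξ : ↥(T.PiYddtp ⊓ T.tp T.PiXuu) → ε.Coeff => fun g : ↥(T.PiYddtp ⊓ T.tp T.PiXuu) =>
        ΓΘ.symm (ξ ⟨_, hmem' g⟩)) '' ε.rootClassOf c =
      ε.rootClassOf (ContH1Aut.autMap D.toTheta D.DeltaTheta α.symm β.symm (symm_toTheta_eq hβ) hΔ'
        (H := D.GtpYdd) (H' := D.GtpYdd) hY c) := by
  have hcl := ε.outer_image_classOf_eq hα hβ hΔ hΔ' hY hY' ΓΘ hΘ hmem c
  -- the two "round trips" `x (x⁻¹ g x) x⁻¹ = g`, `x⁻¹ (x g x⁻¹) x = g`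
  have hrt' : ∀ g : ↥(T.PiYddtp ⊓ T.tp T.PiXuu),
      (⟨x⁻¹ * ((⟨_, hmem' g⟩ : ↥(T.PiYddtp ⊓ T.tp T.PiXuu)) : T.Gtp) * x, hinv' ⟨_, hmem' g⟩⟩ :
        ↥(T.PiYddtp ⊓ T.tp T.PiXuu)) = g := fun g =>
    Subtype.ext (by show x⁻¹ * (x * (g : T.Gtp) * x⁻¹) * x = g; group)
  have hrtY : ∀ g : ↥(T.PiYddtp ⊓ T.tp T.PiXuu),
      (⟨x * ((⟨_, hinv' g⟩ : ↥(T.PiYddtp ⊓ T.tp T.PiXuu)) : T.Gtp) * x⁻¹,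
          hmem ⟨_, (Subgroup.mem_inf.1 (hinv' g)).1⟩⟩ : ↥T.PiYddtp) =
        ⟨g, (Subgroup.mem_inf.1 g.2).1⟩ := fun g =>
    Subtype.ext (by show x * (x⁻¹ * (g : T.Gtp) * x) * x⁻¹ = g; group)
  ext ξ'; constructor
  · rintro ⟨ξ, ⟨F, hF, hpow⟩, rfl⟩
    refine ⟨fun y => ΓΘ.symm (F ⟨_, hmem y⟩), hcl.le ⟨F, hF, rfl⟩, fun g => ?_⟩
    exact (map_pow ΓΘ.symm _ l).symm.trans (congrArg ΓΘ.symm (hpow ⟨_, hmem' g⟩))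
  · rintro ⟨F', hF', hpow'⟩
    obtain ⟨F, hF, rfl⟩ := hcl.ge hF'
    refine ⟨fun g => ΓΘ (ξ' ⟨_, hinv' g⟩), ⟨F, hF, fun g => ?_⟩, ?_⟩
    · have h1 := congrArg ΓΘ (hpow' ⟨_, hinv' g⟩)
      refine (map_pow ΓΘ _ l).symm.trans (h1.trans ?_)
      exact (MulEquiv.apply_symm_apply ΓΘ _).trans (congrArg F (hrtY g))
    · funext g
      exact (MulEquiv.symm_apply_apply ΓΘ _).trans (congrArg ξ' (hrt' g))

/-! ### Orbit collections -/

/-- **Transport of an orbit collection** `{classOf (s·η̈^Θ) | s ∈ S}` by `(γ_x, Γ_Θ)`: it is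
`{classOf (α⁻¹(s)·(autMap α⁻¹ β⁻¹ η̈^Θ)) | s ∈ S}` (L6-t1's equivariance `autMap_conj`); hence, if
`autMap α⁻¹ β⁻¹ η̈^Θ = σ₀·η̈^Θ` (HYPOTHESIS — the [EtTh] content) and `s ↦ α⁻¹(s)·σ₀` maps `S` onto `S`, the
collection is mapped onto itself. [cite: MochizukiEtTh2009, Cor 2.8(iii) p.42] -/
theorem outer_image_orbitColl_eq (hC : D.Compat) [hb : ε.bot.Normal]
    (hα : ∀ g, ε.ι (α g) = x * ε.ι g * x⁻¹) (hβ : ∀ g, β (D.toTheta g) = D.toTheta (α g))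
    (hΔ : ∀ a, a ∈ D.DeltaTheta → β a ∈ D.DeltaTheta) (hΔ' : ∀ a, a ∈ D.DeltaTheta → β.symm a ∈ D.DeltaTheta)
    (hY : ∀ g, g ∈ D.GtpYdd → α g ∈ D.GtpYdd) (hY' : ∀ g, g ∈ D.GtpYdd → α.symm g ∈ D.GtpYdd)
    (ΓΘ : ε.Coeff ≃* ε.Coeff)
    (hΘ : ∀ d : ↥D.DeltaTheta, ΓΘ.symm (ε.coeffOf d) = ε.coeffOf ⟨β.symm d, hΔ' _ d.2⟩)
    (hmem : ∀ y : ↥T.PiYddtp, x * (y : T.Gtp) * x⁻¹ ∈ T.PiYddtp) {σ₀ : D.PiTemp}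
    (hη : haveI := hC.GtpYdd_normal
      ContH1Aut.autMap D.toTheta D.DeltaTheta α.symm β.symm (symm_toTheta_eq hβ) hΔ'
          (H := D.GtpYdd) (H' := D.GtpYdd) hY E.etaDd =
        ContH1.conj D.toTheta D.DeltaTheta σ₀ E.etaDd)
    {S : Set D.PiTemp} (h₁ : ∀ s ∈ S, α.symm s * σ₀ ∈ S) (h₂ : ∀ s ∈ S, α (s * σ₀⁻¹) ∈ S) :
    (fun c => (fun F : ↥T.PiYddtp → ε.Coeff => fun y : ↥T.PiYddtp => ΓΘ.symm (F ⟨_, hmem y⟩)) '' c) ''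
        ε.orbitColl hC S = ε.orbitColl hC S := by
  haveI := hC.GtpYdd_normal
  ext c; constructor
  · rintro ⟨_, ⟨s, hs, rfl⟩, rfl⟩
    refine ⟨α.symm s * σ₀, h₁ s hs, ?_⟩
    show (fun F : ↥T.PiYddtp → ε.Coeff => fun y : ↥T.PiYddtp => ΓΘ.symm (F ⟨_, hmem y⟩)) ''
        ε.classOf (ContH1.conj D.toTheta D.DeltaTheta s E.etaDd) = _
    rw [ε.outer_image_classOf_eq hα hβ hΔ hΔ' hY hY' ΓΘ hΘ hmem, ContH1Aut.autMap_conj, hη,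
      ← ContH1.conj_mul_apply]
  · rintro ⟨s, hs, rfl⟩
    refine ⟨ε.classOf (ContH1.conj D.toTheta D.DeltaTheta (α (s * σ₀⁻¹)) E.etaDd),
      ⟨α (s * σ₀⁻¹), h₂ s hs, rfl⟩, ?_⟩
    show (fun F : ↥T.PiYddtp → ε.Coeff => fun y : ↥T.PiYddtp => ΓΘ.symm (F ⟨_, hmem y⟩)) ''
        ε.classOf (ContH1.conj D.toTheta D.DeltaTheta (α (s * σ₀⁻¹)) E.etaDd) = _
    rw [ε.outer_image_classOf_eq hα hβ hΔ hΔ' hY hY' ΓΘ hΘ hmem, ContH1Aut.autMap_conj, hη,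
      ← ContH1.conj_mul_apply, ContinuousMulEquiv.symm_apply_apply, inv_mul_cancel_right]

/-- **Transport of a root-orbit collection** `{rootClassOf (s·η̈^Θ) | s ∈ S}` by `(γ_x, Γ_Θ)` under the same
hypothesis `autMap α⁻¹ β⁻¹ η̈^Θ = σ₀·η̈^Θ` and `S`-stability: the collection is mapped onto itself.
[cite: MochizukiEtTh2009, Cor 2.8(iii) p.42] -/
theorem outer_image_rootColl_eq (hC : D.Compat) [hb : ε.bot.Normal]
    (hα : ∀ g, ε.ι (α g) = x * ε.ι g * x⁻¹) (hβ : ∀ g, β (D.toTheta g) = D.toTheta (α g))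
    (hΔ : ∀ a, a ∈ D.DeltaTheta → β a ∈ D.DeltaTheta) (hΔ' : ∀ a, a ∈ D.DeltaTheta → β.symm a ∈ D.DeltaTheta)
    (hY : ∀ g, g ∈ D.GtpYdd → α g ∈ D.GtpYdd) (hY' : ∀ g, g ∈ D.GtpYdd → α.symm g ∈ D.GtpYdd)
    (ΓΘ : ε.Coeff ≃* ε.Coeff)
    (hΘ : ∀ d : ↥D.DeltaTheta, ΓΘ.symm (ε.coeffOf d) = ε.coeffOf ⟨β.symm d, hΔ' _ d.2⟩)
    (hmem : ∀ y : ↥T.PiYddtp, x * (y : T.Gtp) * x⁻¹ ∈ T.PiYddtp)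
    (hmem' : ∀ g : ↥(T.PiYddtp ⊓ T.tp T.PiXuu), x * (g : T.Gtp) * x⁻¹ ∈ T.PiYddtp ⊓ T.tp T.PiXuu)
    (hinv' : ∀ g : ↥(T.PiYddtp ⊓ T.tp T.PiXuu), x⁻¹ * (g : T.Gtp) * x ∈ T.PiYddtp ⊓ T.tp T.PiXuu)
    {σ₀ : D.PiTemp}
    (hη : haveI := hC.GtpYdd_normal
      ContH1Aut.autMap D.toTheta D.DeltaTheta α.symm β.symm (symm_toTheta_eq hβ) hΔ'
          (H := D.GtpYdd) (H' := D.GtpYdd) hY E.etaDd =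
        ContH1.conj D.toTheta D.DeltaTheta σ₀ E.etaDd)
    {S : Set D.PiTemp} (h₁ : ∀ s ∈ S, α.symm s * σ₀ ∈ S) (h₂ : ∀ s ∈ S, α (s * σ₀⁻¹) ∈ S) :
    (fun c => (fun ξ : ↥(T.PiYddtp ⊓ T.tp T.PiXuu) → ε.Coeff => fun g : ↥(T.PiYddtp ⊓ T.tp T.PiXuu) =>
        ΓΘ.symm (ξ ⟨_, hmem' g⟩)) '' c) '' ε.rootColl hC S = ε.rootColl hC S := by
  haveI := hC.GtpYdd_normal
  ext c; constructor
  · rintro ⟨_, ⟨s, hs, rfl⟩, rfl⟩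
    refine ⟨α.symm s * σ₀, h₁ s hs, ?_⟩
    show (fun ξ : ↥(T.PiYddtp ⊓ T.tp T.PiXuu) → ε.Coeff => fun g : ↥(T.PiYddtp ⊓ T.tp T.PiXuu) =>
        ΓΘ.symm (ξ ⟨_, hmem' g⟩)) '' ε.rootClassOf (ContH1.conj D.toTheta D.DeltaTheta s E.etaDd) = _
    rw [ε.outer_image_rootClassOf_eq hα hβ hΔ hΔ' hY hY' ΓΘ hΘ hmem hmem' hinv', ContH1Aut.autMap_conj,
      hη, ← ContH1.conj_mul_apply]
  · rintro ⟨s, hs, rfl⟩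
    refine ⟨ε.rootClassOf (ContH1.conj D.toTheta D.DeltaTheta (α (s * σ₀⁻¹)) E.etaDd),
      ⟨α (s * σ₀⁻¹), h₂ s hs, rfl⟩, ?_⟩
    show (fun ξ : ↥(T.PiYddtp ⊓ T.tp T.PiXuu) → ε.Coeff => fun g : ↥(T.PiYddtp ⊓ T.tp T.PiXuu) =>
        ΓΘ.symm (ξ ⟨_, hmem' g⟩)) ''
        ε.rootClassOf (ContH1.conj D.toTheta D.DeltaTheta (α (s * σ₀⁻¹)) E.etaDd) = _
    rw [ε.outer_image_rootClassOf_eq hα hβ hΔ hΔ' hY hY' ΓΘ hΘ hmem hmem' hinv', ContH1Aut.autMap_conj,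
      hη, ← ContH1.conj_mul_apply, ContinuousMulEquiv.symm_apply_apply, inv_mul_cancel_right]

end ThetaSetting.EtaleThetaData.DoubleUnderline.OrbitEmbedding

end Literature.AnabelianGeometry.EtaleTheta

end
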